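import Summits.KontsevichZagierPeriods.KontsevichZagierPeriods.Theorems.SoloBlindZetaTwoReps
import HarnessLib

/-!
# Kontsevich–Zagier's representations of `π` (eq. (1)), inside the rules, I: data

Kontsevich–Zagier open *Periods* (2001, §1.1, eq. (1)) with
`π = ∬_{x²+y²≤1} dx dy = 2∫_{-1}^{1} √(1-x²) dx = ∫_{-1}^{1} dx/√(1-x²) = ∫_{-∞}^{∞} dx/(1+x²)`.
The first and the last member are representations with RATIONAL data in the sense of their §1.2,
and Conjecture 1 predicts that one passes from one to the other by the three rules.  The sequel
`SoloBlindPiDisc` does it with `ℚ`-rational moves only; this file sets up the data: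

* the one-dimensional representations `C = [ℝ, 1/(1+x²)]` (value `π`), `C/2 = [ℝ, 1/(2(1+x²))]`
  and `I = [(0,1], 1]`, all generators of the rank-one ring `B(π)`;
* the closed disc `D̄ = {x²+y²≤1}` and its pieces (right/left half-discs, the null diameter
  `{x=0}`), the strip `ℝ × (0,1]`, their semialgebraicity, and the representations `[D̄,1]`, …;
* the domain and integrand of the Fubini product `(C/2) × I` (the strip with `1/(2(1+u²))`);
* `exists_reflectionChart`: the reflection `(x,y) ↦ (-x,y)` of the left half-disc onto the right
  one, in the pinned chart format of `SoloBlindZetaTwoCharts`.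

References: M. Kontsevich, D. Zagier, *Periods* (2001), §1.1 eq. (1), §1.2.
-/

noncomputable section

namespace Summit.KontsevichZagierPeriods.KontsevichZagierPeriods.Theorems

open Set MeasureTheory
open Literature.ModelTheory.ExponentialFields (IsSemialgebraic isSemialgebraic_setOf_eval_pos
  isSemialgebraic_setOf_eval_le isSemialgebraic_setOf_eval_lt isSemialgebraic_setOf_eval_eq_zero
  isSemialgebraic_univ)
open MvPolynomial (aeval X)
open Literature.NumberTheory.Transcendental
open Literature.NumberTheory.Transcendental.KZ

namespace SoloBlind

/-! ## One-dimensional representations on the whole line -/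

/-- `line ℝ = ℝ¹`. -/
theorem line_univ : line (univ : Set ℝ) = univ := by
  ext x
  simp

/-- `ℝ¹` is `ℚ`-semialgebraic. -/
theorem isSemialgebraic_line_univ : IsSemialgebraic ℚ (line (univ : Set ℝ)) := by
  rw [line_univ]
  exact isSemialgebraic_univ

/-- **`C = [ℝ, 1/(1+x²)]`**, the last member of Kontsevich–Zagier's eq. (1). -/
def cauchyLine : IntegralRep 1 :=
  lineRep univ (fun t => 1 / (1 + t ^ 2)) isSemialgebraic_line_univ
    (isSemialgebraicFunOn_atan_integrand isAlgebraic_one isSemialgebraic_line_univ)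
    (integrable_inv_one_add_sq.integrableOn.congr_fun (fun t _ => by rw [one_div])
      MeasurableSet.univ)

/-- `value C = π`. -/
theorem cauchyLine_value : cauchyLine.value = Real.pi := by
  rw [cauchyLine, value_lineRep, Measure.restrict_univ]
  simp only [one_div, integral_univ_inv_one_add_sq]

/-- `C` has KZ's literal rational shape. -/
theorem isRational_cauchyLine : cauchyLine.IsRational := by
  refine ⟨1, 1 + X 0 ^ 2, fun x _ => ?_, fun x _ => ?_⟩
  · have : (0:ℝ) < 1 + x 0 ^ 2 := by positivity
    simpa using this.ne'
  · simp [cauchyLine]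

/-- `C` is a generator of `B(π)`. -/
theorem of_cauchyLine_mem_lineGens : of cauchyLine ∈ lineGens Real.pi :=
  ⟨1, cauchyLine, le_rfl, isRational_cauchyLine,
    ⟨0, 1, isAlgebraic_zero, isAlgebraic_one, by rw [cauchyLine_value]; ring⟩, rfl⟩

/-- `C/2 = [ℝ, 1/(2(1+x²))]`. -/
def halfCauchyLine : IntegralRep 1 :=
  lineRep univ (fun t => 1 / (2 * (1 + t ^ 2))) isSemialgebraic_line_univ
    ((isSemialgebraicFunOn_aeval_div_aeval isSemialgebraic_line_univ 1
      (2 * (1 + X 0 ^ 2) : MvPolynomial (Fin 1) ℚ) fun x _ => by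
        have : (0:ℝ) < 2 * (1 + x 0 ^ 2) := by positivity
        simpa using this.ne').congr fun x _ => by simp)
    ((integrable_inv_one_add_sq.const_mul (1 / 2)).integrableOn.congr_fun
      (fun t _ => by
        show (1:ℝ) / 2 * (1 + t ^ 2)⁻¹ = 1 / (2 * (1 + t ^ 2))
        rw [← one_div, one_div_mul_one_div]) MeasurableSet.univ)

/-- `value (C/2) = π/2`. -/
theorem halfCauchyLine_value : halfCauchyLine.value = Real.pi / 2 := by
  rw [halfCauchyLine, value_lineRep, Measure.restrict_univ]
  have h : (fun t : ℝ => 1 / (2 * (1 + t ^ 2))) = fun t => (1 / 2 : ℝ) * (1 + t ^ 2)⁻¹ :=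
    funext fun t => by rw [← one_div, one_div_mul_one_div]
  rw [h, integral_const_mul, integral_univ_inv_one_add_sq]
  ring

/-- `C/2` has KZ's literal rational shape. -/
theorem isRational_halfCauchyLine : halfCauchyLine.IsRational := by
  refine ⟨1, 2 * (1 + X 0 ^ 2), fun x _ => ?_, fun x _ => ?_⟩
  · have : (0:ℝ) < 2 * (1 + x 0 ^ 2) := by positivity
    simpa using this.ne'
  · simp [halfCauchyLine]

/-- `C/2` is a generator of `B(π)`. -/
theorem of_halfCauchyLine_mem_lineGens : of halfCauchyLine ∈ lineGens Real.pi :=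
  ⟨1, halfCauchyLine, le_rfl, isRational_halfCauchyLine,
    ⟨0, ((1 / 2 : ℚ) : ℝ), isAlgebraic_zero, isAlgebraic_rat ℚ (1 / 2), by
      rw [halfCauchyLine_value]; push_cast; ring⟩, rfl⟩

/-- `I = [(0,1], 1]`. -/
def unitIoc : IntegralRep 1 :=
  lineRep (Ioc 0 1) (fun _ => 1) (isSemialgebraic_line_Ioc isAlgebraic_zero isAlgebraic_one)
    (isSemialgebraicFunOn_const_of_isAlgebraic (isSemialgebraic_line_Ioc isAlgebraic_zero
      isAlgebraic_one) isAlgebraic_one)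
    (integrableOn_const (by rw [Real.volume_Ioc]; exact ENNReal.ofReal_ne_top))

/-- `value I = 1`. -/
theorem unitIoc_value : unitIoc.value = 1 := by
  rw [unitIoc, value_lineRep, setIntegral_const, Real.volume_real_Ioc]
  norm_num

/-- `I` has KZ's literal rational shape. -/
theorem isRational_unitIoc : unitIoc.IsRational :=
  ⟨1, 1, fun x _ => by simp, fun x _ => by simp [unitIoc]⟩

/-- `I` is a generator of `B(π)`. -/
theorem of_unitIoc_mem_lineGens : of unitIoc ∈ lineGens Real.pi :=
  ⟨1, unitIoc, le_rfl, isRational_unitIoc,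
    ⟨1, 0, isAlgebraic_one, isAlgebraic_zero, by rw [unitIoc_value]; ring⟩, rfl⟩

/-! ## The disc and its pieces -/

/-- Kontsevich–Zagier's closed unit disc `D̄ = {x² + y² ≤ 1}`. -/
def kzDisc : Set (Fin 2 → ℝ) := {z | z 0 ^ 2 + z 1 ^ 2 ≤ 1}

/-- The right half-disc `{x > 0, x² + y² ≤ 1}`. -/
def kzHalfDiscPos : Set (Fin 2 → ℝ) := {z | 0 < z 0 ∧ z 0 ^ 2 + z 1 ^ 2 ≤ 1}

/-- The closed left half-disc `{x ≤ 0, x² + y² ≤ 1}`. -/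
def kzHalfDiscNonpos : Set (Fin 2 → ℝ) := {z | z 0 ≤ 0 ∧ z 0 ^ 2 + z 1 ^ 2 ≤ 1}

/-- The left half-disc `{x < 0, x² + y² ≤ 1}`. -/
def kzHalfDiscNeg : Set (Fin 2 → ℝ) := {z | z 0 < 0 ∧ z 0 ^ 2 + z 1 ^ 2 ≤ 1}

/-- The vertical diameter `{x = 0, x² + y² ≤ 1}` (a null set). -/
def kzDiscAxis : Set (Fin 2 → ℝ) := {z | z 0 = 0 ∧ z 0 ^ 2 + z 1 ^ 2 ≤ 1}

/-- The strip `ℝ × (0,1]`. -/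
def kzStrip : Set (Fin 2 → ℝ) := {z | 0 < z 1 ∧ z 1 ≤ 1}

/-- Membership in `D̄`, unfolded. -/
theorem mem_kzDisc {z : Fin 2 → ℝ} : z ∈ kzDisc ↔ z 0 ^ 2 + z 1 ^ 2 ≤ 1 := Iff.rfl

/-- Membership in the right half-disc, unfolded. -/
theorem mem_kzHalfDiscPos {z : Fin 2 → ℝ} :
    z ∈ kzHalfDiscPos ↔ 0 < z 0 ∧ z 0 ^ 2 + z 1 ^ 2 ≤ 1 := Iff.rfl

/-- Membership in the closed left half-disc, unfolded. -/
theorem mem_kzHalfDiscNonpos {z : Fin 2 → ℝ} :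
    z ∈ kzHalfDiscNonpos ↔ z 0 ≤ 0 ∧ z 0 ^ 2 + z 1 ^ 2 ≤ 1 := Iff.rfl

/-- Membership in the left half-disc, unfolded. -/
theorem mem_kzHalfDiscNeg {z : Fin 2 → ℝ} :
    z ∈ kzHalfDiscNeg ↔ z 0 < 0 ∧ z 0 ^ 2 + z 1 ^ 2 ≤ 1 := Iff.rfl

/-- Membership in the diameter, unfolded. -/
theorem mem_kzDiscAxis {z : Fin 2 → ℝ} :
    z ∈ kzDiscAxis ↔ z 0 = 0 ∧ z 0 ^ 2 + z 1 ^ 2 ≤ 1 := Iff.rfl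

/-- Membership in the strip, unfolded. -/
theorem mem_kzStrip {z : Fin 2 → ℝ} : z ∈ kzStrip ↔ 0 < z 1 ∧ z 1 ≤ 1 := Iff.rfl

/-- `D̄` is `ℚ`-semialgebraic. -/
theorem isSemialgebraic_kzDisc : IsSemialgebraic ℚ kzDisc := by
  have h : IsSemialgebraic ℚ {x : Fin 2 → ℝ |
      aeval x (X 0 ^ 2 + X 1 ^ 2 : MvPolynomial (Fin 2) ℚ) ≤
        aeval x (1 : MvPolynomial (Fin 2) ℚ)} :=
    isSemialgebraic_setOf_eval_le _ _
  convert h using 1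
  ext z
  simp [kzDisc]

/-- The right half-disc is `ℚ`-semialgebraic. -/
theorem isSemialgebraic_kzHalfDiscPos : IsSemialgebraic ℚ kzHalfDiscPos := by
  convert (isSemialgebraic_setOf_eval_pos (R := ℝ) (X 0 : MvPolynomial (Fin 2) ℚ)).inter
    isSemialgebraic_kzDisc using 1
  ext z
  simp [kzHalfDiscPos, kzDisc]

/-- The closed left half-disc is `ℚ`-semialgebraic. -/
theorem isSemialgebraic_kzHalfDiscNonpos : IsSemialgebraic ℚ kzHalfDiscNonpos := by
  have h : IsSemialgebraic ℚ {x : Fin 2 → ℝ |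
      aeval x (X 0 : MvPolynomial (Fin 2) ℚ) ≤ aeval x (0 : MvPolynomial (Fin 2) ℚ)} :=
    isSemialgebraic_setOf_eval_le _ _
  convert h.inter isSemialgebraic_kzDisc using 1
  ext z
  simp [kzHalfDiscNonpos, kzDisc]

/-- The left half-disc is `ℚ`-semialgebraic. -/
theorem isSemialgebraic_kzHalfDiscNeg : IsSemialgebraic ℚ kzHalfDiscNeg := by
  have h : IsSemialgebraic ℚ {x : Fin 2 → ℝ |
      aeval x (X 0 : MvPolynomial (Fin 2) ℚ) < aeval x (0 : MvPolynomial (Fin 2) ℚ)} :=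
    isSemialgebraic_setOf_eval_lt _ _
  convert h.inter isSemialgebraic_kzDisc using 1
  ext z
  simp [kzHalfDiscNeg, kzDisc]

/-- The diameter is `ℚ`-semialgebraic. -/
theorem isSemialgebraic_kzDiscAxis : IsSemialgebraic ℚ kzDiscAxis := by
  convert (isSemialgebraic_setOf_eval_eq_zero (R := ℝ) (X 0 : MvPolynomial (Fin 2) ℚ)).inter
    isSemialgebraic_kzDisc using 1
  ext z
  simp [kzDiscAxis, kzDisc]

/-- `D̄` is bounded. -/
theorem isBounded_kzDisc : Bornology.IsBounded kzDisc := by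
  refine (Metric.isBounded_closedBall (x := (0 : Fin 2 → ℝ)) (r := 1)).subset fun z hz => ?_
  rw [mem_kzDisc] at hz
  rw [Metric.mem_closedBall, dist_zero_right, pi_norm_le_iff_of_nonneg zero_le_one]
  refine Fin.forall_fin_two.mpr ⟨?_, ?_⟩
  · rw [Real.norm_eq_abs, ← sq_le_one_iff_abs_le_one]
    nlinarith [sq_nonneg (z 1)]
  · rw [Real.norm_eq_abs, ← sq_le_one_iff_abs_le_one]
    nlinarith [sq_nonneg (z 0)]

/-- The constant `1` is integrable on `D̄`. -/
theorem integrableOn_one_kzDisc : IntegrableOn (fun _ : Fin 2 → ℝ => (1 : ℝ)) kzDisc :=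
  integrableOn_const isBounded_kzDisc.measure_lt_top.ne

/-- **The diameter is Lebesgue-null** (it lies in the proper subspace `{x = 0}`). -/
theorem volume_kzDiscAxis : volume kzDiscAxis = 0 := by
  let L : (Fin 2 → ℝ) →ₗ[ℝ] ℝ := LinearMap.proj (R := ℝ) (φ := fun _ : Fin 2 => ℝ) 0
  have hS : LinearMap.ker L ≠ ⊤ := by
    intro h
    have h1 : (![1, 0] : Fin 2 → ℝ) ∈ LinearMap.ker L := h ▸ Submodule.mem_top
    rw [LinearMap.mem_ker] at h1
    simp [L] at h1
  refine measure_mono_null (fun z hz => ?_) (Measure.addHaar_submodule volume (LinearMap.ker L) hS)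
  rw [mem_kzDiscAxis] at hz
  rw [SetLike.mem_coe, LinearMap.mem_ker]
  simp [L, hz.1]

/-! ## The representations -/

/-- **`[D̄, 1]`**, the first member of Kontsevich–Zagier's eq. (1): the area of the unit disc. -/
def discRep : IntegralRep 2 :=
  ratRep kzDisc (fun _ => 1) 1 1 isSemialgebraic_kzDisc (fun _ _ => by simp) (fun _ _ => by simp)
    integrableOn_one_kzDisc

/-- `[D̄, 1]` has KZ's literal rational shape. -/
theorem isRational_discRep : discRep.IsRational := isRational_ratRep

/-- `[{x>0, x²+y²≤1}, 1]`. -/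
def halfDiscPosRep : IntegralRep 2 :=
  ratRep kzHalfDiscPos (fun _ => 1) 1 1 isSemialgebraic_kzHalfDiscPos (fun _ _ => by simp)
    (fun _ _ => by simp) (integrableOn_one_kzDisc.mono_set fun _ hz => hz.2)

/-- `[{x≤0, x²+y²≤1}, 1]`. -/
def halfDiscNonposRep : IntegralRep 2 :=
  ratRep kzHalfDiscNonpos (fun _ => 1) 1 1 isSemialgebraic_kzHalfDiscNonpos (fun _ _ => by simp)
    (fun _ _ => by simp) (integrableOn_one_kzDisc.mono_set fun _ hz => hz.2)

/-- `[{x<0, x²+y²≤1}, 1]`. -/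
def halfDiscNegRep : IntegralRep 2 :=
  ratRep kzHalfDiscNeg (fun _ => 1) 1 1 isSemialgebraic_kzHalfDiscNeg (fun _ _ => by simp)
    (fun _ _ => by simp) (integrableOn_one_kzDisc.mono_set fun _ hz => hz.2)

/-- `[{x=0, y²≤1}, 1]` (null domain). -/
def discAxisRep : IntegralRep 2 :=
  ratRep kzDiscAxis (fun _ => 1) 1 1 isSemialgebraic_kzDiscAxis (fun _ _ => by simp)
    (fun _ _ => by simp) (integrableOn_one_kzDisc.mono_set fun _ hz => hz.2)

/-- The domain of `(C/2) × I` is the strip. -/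
theorem prod_halfCauchy_unitIoc_domain : (halfCauchyLine.prod unitIoc).domain = kzStrip := by
  ext z
  simp only [IntegralRep.prod_domain, IntegralRep.mem_prodDomain, halfCauchyLine, unitIoc,
    lineRep_domain, mem_line, mem_univ, true_and, mem_Ioc,
    (show (Fin.castAdd 1 (0 : Fin 1) : Fin 2) = 0 from rfl),
    (show (Fin.natAdd 1 (0 : Fin 1) : Fin 2) = 1 from rfl)]
  exact Iff.rfl

/-- The integrand of `(C/2) × I` is `1/(2(1+u²))`. -/
theorem prod_halfCauchy_unitIoc_integrand (z : Fin 2 → ℝ) :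
    (halfCauchyLine.prod unitIoc).integrand z = 1 / (2 * (1 + z 0 ^ 2)) := by
  rw [IntegralRep.prod_integrand_eq, IntegralRep.prodFun_apply]
  simp only [halfCauchyLine, unitIoc, lineRep_integrand,
    (show (Fin.castAdd 1 (0 : Fin 1) : Fin 2) = 0 from rfl), mul_one]

/-! ## The reflection chart -/

/-- **The reflection chart** `Φ(x,y) = (-x, y)`: a `ℚ`-linear map of the left half-disc ONTO the
right one, injective, with `|det DΦ| = 1`. -/
theorem exists_reflectionChart :
    ∃ (Φ : (Fin 2 → ℝ) → (Fin 2 → ℝ)) (Φ' : (Fin 2 → ℝ) → (Fin 2 → ℝ) →L[ℝ] (Fin 2 → ℝ)),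
      (∀ z, Φ z 0 = -(z 0)) ∧ (∀ z, Φ z 1 = z 1) ∧
      IsSemialgebraicMapOn ℚ kzHalfDiscNeg Φ ∧ (∀ z ∈ kzHalfDiscNeg, HasFDerivAt Φ (Φ' z) z) ∧
      InjOn Φ kzHalfDiscNeg ∧ Φ '' kzHalfDiscNeg = kzHalfDiscPos ∧
      (∀ z ∈ kzHalfDiscNeg, |(Φ' z).det| = 1) := by
  set Φ : (Fin 2 → ℝ) → (Fin 2 → ℝ) := fun z => ![-(z 0), z 1] with hΦ
  set Φ' : (Fin 2 → ℝ) → (Fin 2 → ℝ) →L[ℝ] (Fin 2 → ℝ) :=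
    fun _ => LinearMap.toContinuousLinearMap
      (Matrix.toLin' (!![-1, 0; 0, 1] : Matrix (Fin 2) (Fin 2) ℝ)) with hΦ'
  have hΦ0 : ∀ z, Φ z 0 = -(z 0) := fun z => rfl
  have hΦ1 : ∀ z, Φ z 1 = z 1 := fun z => rfl
  have hΦ'0 : ∀ z v : Fin 2 → ℝ, Φ' z v 0 = -(v 0) := by
    intro z v
    change Matrix.toLin' (!![-1, 0; 0, 1] : Matrix (Fin 2) (Fin 2) ℝ) v 0 = _
    rw [Matrix.toLin'_apply]
    simp [Matrix.mulVec, dotProduct, Fin.sum_univ_two]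
  have hΦ'1 : ∀ z v : Fin 2 → ℝ, Φ' z v 1 = v 1 := by
    intro z v
    change Matrix.toLin' (!![-1, 0; 0, 1] : Matrix (Fin 2) (Fin 2) ℝ) v 1 = _
    rw [Matrix.toLin'_apply]
    simp [Matrix.mulVec, dotProduct, Fin.sum_univ_two]
  have hdet : ∀ z, (Φ' z).det = -1 := by
    intro z
    change LinearMap.det (Matrix.toLin' (!![-1, 0; 0, 1] : Matrix (Fin 2) (Fin 2) ℝ)) = _
    rw [LinearMap.det_toLin', Matrix.det_fin_two]
    simp only [Matrix.of_apply, Matrix.cons_val', Matrix.cons_val_zero, Matrix.cons_val_one,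
      Matrix.cons_val_fin_one, Matrix.empty_val']
    norm_num
  have hderiv : ∀ z, HasFDerivAt Φ (Φ' z) z := by
    intro z
    have h0 : HasFDerivAt (fun y : Fin 2 → ℝ => y 0)
        (ContinuousLinearMap.proj (R := ℝ) (φ := fun _ : Fin 2 => ℝ) 0) z := hasFDerivAt_apply 0 z
    have h1 : HasFDerivAt (fun y : Fin 2 → ℝ => y 1)
        (ContinuousLinearMap.proj (R := ℝ) (φ := fun _ : Fin 2 => ℝ) 1) z := hasFDerivAt_apply 1 z
    rw [hasFDerivAt_pi']
    refine Fin.forall_fin_two.mpr ⟨?_, ?_⟩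
    · have hf : (fun y : Fin 2 → ℝ => Φ y 0) = fun y => -(y 0) := funext fun y => by rw [hΦ0]
      rw [hf]
      refine h0.neg.congr_fderiv (ContinuousLinearMap.ext fun v => ?_)
      simp [hΦ'0]
    · have hf : (fun y : Fin 2 → ℝ => Φ y 1) = fun y => y 1 := funext fun y => by rw [hΦ1]
      rw [hf]
      refine h1.congr_fderiv (ContinuousLinearMap.ext fun v => ?_)
      simp [hΦ'1]
  refine ⟨Φ, Φ', hΦ0, hΦ1, ?_, fun z _ => hderiv z, ?_, ?_, fun z _ => ?_⟩
  · convert isSemialgebraicMapOn_aeval isSemialgebraic_kzHalfDiscNeg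
      ![-MvPolynomial.X 0, (MvPolynomial.X 1 : MvPolynomial (Fin 2) ℚ)] using 2 with z
    funext i
    fin_cases i
    · simp [hΦ0]
    · simp [hΦ1]
  · intro x _ y _ hxy
    have e0 := congrFun hxy 0
    have e1 := congrFun hxy 1
    simp only [hΦ0, hΦ1, neg_inj] at e0 e1
    funext i
    fin_cases i
    · exact e0
    · exact e1
  · ext w
    constructor
    · rintro ⟨z, hz, rfl⟩
      rw [mem_kzHalfDiscNeg] at hz
      rw [mem_kzHalfDiscPos]
      simp only [hΦ0, hΦ1, neg_pos, neg_sq]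
      exact hz
    · intro hw
      rw [mem_kzHalfDiscPos] at hw
      refine ⟨![-(w 0), w 1], ?_, ?_⟩
      · rw [mem_kzHalfDiscNeg]
        change -(w 0) < 0 ∧ (-(w 0)) ^ 2 + w 1 ^ 2 ≤ 1
        rw [neg_lt_zero, neg_sq]
        exact hw
      · funext i
        fin_cases i
        · change -(-(w 0)) = w 0
          rw [neg_neg]
        · rfl
  · rw [hdet z]
    norm_num

end SoloBlind

end Summit.KontsevichZagierPeriods.KontsevichZagierPeriods.Theorems
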